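import Literature.AlgebraicGeometry.Smoothening.ConormalSplitting
import Mathlib.RingTheory.Kaehler.Polynomial
import Mathlib.RingTheory.TensorProduct.Free
import Mathlib.LinearAlgebra.Matrix.Rank
import Mathlib.LinearAlgebra.Matrix.NonsingularInverse
import Mathlib.LinearAlgebra.FiniteDimensional.Lemmas
import Mathlib.RingTheory.Noetherian.Basic
import HarnessLib

/-!
# Relations with independent differentials at a point (the choice in the Jacobian criterion)

Topic: `Literature/AlgebraicGeometry/Smoothening`. Let `B = R[T₁, …, Tₙ]`, `I ⊆ B` an ideal,
`A = B/I` (`X = Spec A ⊆ 𝔸ⁿ_R`) and `A → L` a point of `X` with values in a field. If the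
fibre of the differentials at the point, `L ⊗_A Ω[A⁄R]`, has dimension `d`, then there are
`n - d` elements `f₁, …, f_{n-d} ∈ I` and `n - d` coordinates `a(1), …, a(n-d)` such that the
minor `det (∂f_j/∂T_{a(i)})` does not vanish at the point (`exists_jacobianMinor_ne_zero`). This
is the choice made in every proof of the Jacobian criterion (Görtz–Wedhorn I, Def. 6.14; Bosch–Lütkebohmert–Raynaud, *Néron Models*, Prop. 2.2/7; proof of Lemma 3.3/1): the
conormal sequence `I/I² → A ⊗_B Ω[B⁄R] → Ω[A⁄R] → 0` base-changed to `L` shows that the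
differentials `df`, `f ∈ I`, span the kernel of `Lⁿ = L ⊗_B Ω[B⁄R] → L ⊗_A Ω[A⁄R]`, of dimension
`n - d`; a basis `df₁, …, df_{n-d}` extracted from them has an invertible maximal minor. With
`JacobianCriterion.lean`, `Z = Spec (B/(f))[1/Δ]` is then a smooth `R`-scheme of relative
dimension `d` containing `X ∩ D(Δ)` as a closed subscheme, through the given point.

* `exists_submatrix_det_ne_zero_of_linearIndependent` — rows of a `c × n` matrix over a field
  linearly independent ⇒ some `c × c` minor is non-zero [folklore linear algebra];
* `repr_tmul_D` — coordinates of `1 ⊗ df` in `L ⊗_B Ω[B⁄R] ≅ Lⁿ` are the values `(∂f/∂Tⱼ)(x)`;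
* `exists_jacobianMinor_ne_zero` — the statement above.

No named facts are introduced (D-0026).

## References

* U. Görtz, T. Wedhorn, *Algebraic Geometry I: Schemes*, 2nd ed. (2020), Def. 6.14 (p. 159).
  [GortzWedhorn2020]
* S. Bosch, W. Lütkebohmert, M. Raynaud, *Néron Models*, Springer 1990, Prop. 2.2/7,
  Lemma 3.3/1. [BLRNeronModels1990] (Not held; numbers only.)
-/

noncomputable section

open scoped TensorProduct
open MvPolynomial KaehlerDifferential Module

namespace Literature.AlgebraicGeometry.Smoothening

universe u

/-! ### Linear algebra: independent rows have an invertible maximal minor -/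

section LinearAlgebra

variable {L : Type u} [Field L] {c n : ℕ}

/-- If the `c` rows of a `c × n` matrix over a field are linearly independent, then for some
injective choice `a` of `c` columns the square submatrix on these columns has non-zero
determinant (row rank = column rank). [folklore] -/
theorem exists_submatrix_det_ne_zero_of_linearIndependent (M : Matrix (Fin c) (Fin n) L)
    (hM : LinearIndependent L M.row) :
    ∃ a : Fin c → Fin n, Function.Injective a ∧ (M.submatrix id a).det ≠ 0 := by
  classical
  -- the columns span `Fin c → L`
  have hrank : M.rank = c := by
    rw [Matrix.rank_eq_finrank_span_row, finrank_span_eq_card hM, Fintype.card_fin]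
  have hcols : Submodule.span L (Set.range M.col) = ⊤ := by
    apply Submodule.eq_top_of_finrank_eq
    rw [← Matrix.rank_eq_finrank_span_cols, hrank, Module.finrank_fintype_fun_eq_card,
      Fintype.card_fin]
  -- extract a basis from the columns
  obtain ⟨κ, a, ha, hspan, hli⟩ := exists_linearIndependent' L M.col
  haveI : Finite κ := Finite.of_injective a ha
  letI : Fintype κ := Fintype.ofFinite κ
  have hcard : Fintype.card κ = c := by
    have h := finrank_span_eq_card hli
    rw [hspan, hcols, finrank_top, Module.finrank_fintype_fun_eq_card, Fintype.card_fin] at h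
    exact h.symm
  obtain ⟨e⟩ : Nonempty (Fin c ≃ κ) := ⟨(Fintype.equivFinOfCardEq hcard).symm⟩
  refine ⟨a ∘ e, ha.comp e.injective, ?_⟩
  have hli' : LinearIndependent L (M.submatrix id (a ∘ e)).col := by
    have : (M.submatrix id (a ∘ e)).col = (M.col ∘ a) ∘ e := by
      funext j
      rfl
    rw [this]
    exact hli.comp e e.injective
  have hunit : IsUnit (M.submatrix id (a ∘ e)) := Matrix.linearIndependent_cols_iff_isUnit.mp hli'
  exact ((Matrix.isUnit_iff_isUnit_det _).mp hunit).ne_zero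

end LinearAlgebra

/-! ### Coordinates of differentials at a point -/

section Kaehler

variable {R : Type u} [CommRing R] {n : ℕ} (L : Type u) [Field L]
  [Algebra (MvPolynomial (Fin n) R) L]

/-- The basis `1 ⊗ dT₁, …, 1 ⊗ dTₙ` of `L ⊗_B Ω[B⁄R]`, `B = R[T₁, …, Tₙ]`. [folklore] -/
abbrev tensorKaehlerBasis :
    Basis (Fin n) L (L ⊗[MvPolynomial (Fin n) R] Ω[MvPolynomial (Fin n) R⁄R]) :=
  Algebra.TensorProduct.basis L (KaehlerDifferential.mvPolynomialBasis R (Fin n))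

/-- **The coordinates of `1 ⊗ df` at the point are the values of the partial derivatives**:
`(1 ⊗ df)_j = (∂f/∂Tⱼ)(x)` in the basis `1 ⊗ dTⱼ`. [folklore] -/
theorem repr_tmul_D (f : MvPolynomial (Fin n) R) (j : Fin n) :
    (tensorKaehlerBasis L).repr (1 ⊗ₜ D R (MvPolynomial (Fin n) R) f) j =
      algebraMap (MvPolynomial (Fin n) R) L (pderiv j f) := by
  rw [Algebra.TensorProduct.basis_repr_tmul, one_smul, Finsupp.mapRange_apply,
    KaehlerDifferential.mvPolynomialBasis_repr_apply]

end Kaehler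

/-! ### Relations with independent differentials -/

section Relations

variable {R : Type u} [CommRing R] {n : ℕ} (I : Ideal (MvPolynomial (Fin n) R)) (L : Type u)
  [Field L] [Algebra (MvPolynomial (Fin n) R) L] [Algebra (MvPolynomial (Fin n) R ⧸ I) L]
  [IsScalarTower (MvPolynomial (Fin n) R) (MvPolynomial (Fin n) R ⧸ I) L]

/-- In `L ⊗ M`, the pure tensors `1 ⊗ m` span. [folklore] -/
theorem span_one_tmul_eq_top {S : Type u} [CommRing S] [Algebra S L] (M : Type u) [AddCommGroup M]
    [Module S M] : Submodule.span L (Set.range fun m : M => (1 : L) ⊗ₜ[S] m) = ⊤ := by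
  rw [eq_top_iff]
  rintro x -
  induction x using TensorProduct.induction_on with
  | zero => exact Submodule.zero_mem _
  | tmul l m =>
    have : l ⊗ₜ[S] m = l • ((1 : L) ⊗ₜ[S] m) := by rw [TensorProduct.smul_tmul', smul_eq_mul, mul_one]
    rw [this]
    exact Submodule.smul_mem _ _ (Submodule.subset_span ⟨m, rfl⟩)
  | add x y hx hy => exact Submodule.add_mem _ hx hy

/-- **Relations with independent differentials at a point** (the choice in the Jacobian
criterion; GW I Def. 6.14, BLR 2.2/7 and proof of Lemma 3.3/1). Let `B = R[T₁, …, Tₙ]`,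
`I ⊆ B` an ideal, `A = B/I` and `A → L` a point of `Spec A` with values in a field `L`. If
`dim_L (L ⊗_A Ω[A⁄R]) = d`, then there are `f₁, …, f_{n-d} ∈ I` and an injective
`a : Fin (n-d) → Fin n` such that the minor `det (∂f_j/∂T_{a(i)})` is non-zero at the point.
Proof: base change to `L` of the conormal sequence `I/I² → A ⊗_B Ω[B⁄R] → Ω[A⁄R] → 0`: the
`1 ⊗ df`, `f ∈ I`, span the kernel of `Lⁿ → L ⊗_A Ω[A⁄R]`, of dimension `n - d`; a basis
extracted from them has an invertible maximal minor. [cite: GortzWedhorn2020, Def. 6.14 (p. 159)] -/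
theorem exists_jacobianMinor_ne_zero {d : ℕ}
    (hd : Module.finrank L (L ⊗[MvPolynomial (Fin n) R ⧸ I] Ω[(MvPolynomial (Fin n) R ⧸ I)⁄R]) = d)
    (hdn : d ≤ n) :
    ∃ (f : Fin (n - d) → MvPolynomial (Fin n) R) (_ : ∀ i, f i ∈ I) (a : Fin (n - d) → Fin n),
      Function.Injective a ∧
        algebraMap (MvPolynomial (Fin n) R) L
          (Matrix.det (Matrix.of fun i j => (f j).pderiv (a i))) ≠ 0 := by
  classical
  let E : Algebra.Extension R (MvPolynomial (Fin n) R ⧸ I) :=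
    quotientExtension R (MvPolynomial (Fin n) R) I
  -- `V = L ⊗[A] (A ⊗[B] Ω_B) ≅ L ⊗[B] Ω_B` (`A = B/I`), of dimension `n`
  let canc : L ⊗[MvPolynomial (Fin n) R ⧸ I] E.CotangentSpace ≃ₗ[L]
      L ⊗[MvPolynomial (Fin n) R] Ω[MvPolynomial (Fin n) R⁄R] :=
    TensorProduct.AlgebraTensorModule.cancelBaseChange (MvPolynomial (Fin n) R)
      (MvPolynomial (Fin n) R ⧸ I) L L Ω[MvPolynomial (Fin n) R⁄R]
  haveI : FiniteDimensional L (L ⊗[MvPolynomial (Fin n) R] Ω[MvPolynomial (Fin n) R⁄R]) :=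
    Module.Finite.of_basis (tensorKaehlerBasis L)
  haveI : FiniteDimensional L (L ⊗[MvPolynomial (Fin n) R ⧸ I] E.CotangentSpace) :=
    Module.Finite.equiv canc.symm
  have hV : Module.finrank L (L ⊗[MvPolynomial (Fin n) R ⧸ I] E.CotangentSpace) = n := by
    rw [canc.finrank_eq, Module.finrank_eq_card_basis (tensorKaehlerBasis L), Fintype.card_fin]
  -- `τ : V → L ⊗[A] Ω_A`, surjective, exact with the base change `γ` of the cotangent complex
  let τ : L ⊗[MvPolynomial (Fin n) R ⧸ I] E.CotangentSpace →ₗ[L]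
      L ⊗[MvPolynomial (Fin n) R ⧸ I] Ω[(MvPolynomial (Fin n) R ⧸ I)⁄R] := E.toKaehler.baseChange L
  let γ : L ⊗[MvPolynomial (Fin n) R ⧸ I] E.Cotangent →ₗ[L]
      L ⊗[MvPolynomial (Fin n) R ⧸ I] E.CotangentSpace := E.cotangentComplex.baseChange L
  have hτsurj : Function.Surjective τ := by
    change Function.Surjective (E.toKaehler.lTensor L)
    exact LinearMap.lTensor_surjective L E.toKaehler_surjective
  have hexact : Function.Exact γ τ := by
    change Function.Exact (E.cotangentComplex.lTensor L) (E.toKaehler.lTensor L)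
    exact lTensor_exact L E.exact_cotangentComplex_toKaehler E.toKaehler_surjective
  haveI : FiniteDimensional L (L ⊗[MvPolynomial (Fin n) R ⧸ I] Ω[(MvPolynomial (Fin n) R ⧸ I)⁄R]) :=
    Module.Finite.of_surjective τ hτsurj
  -- dimension of the kernel
  have hker : Module.finrank L (LinearMap.ker τ) = n - d := by
    have h := LinearMap.finrank_range_add_finrank_ker τ
    rw [LinearMap.range_eq_top.mpr hτsurj, finrank_top, hd, hV] at h
    omega
  -- the kernel is spanned by the `1 ⊗ df`, `f ∈ I`
  have hmemker : ∀ x : I, (x : MvPolynomial (Fin n) R) ∈ E.ker := fun x => by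
    rw [ker_quotientExtension]
    exact x.2
  let v : I → L ⊗[MvPolynomial (Fin n) R ⧸ I] E.CotangentSpace := fun x =>
    (1 : L) ⊗ₜ[MvPolynomial (Fin n) R ⧸ I]
      E.cotangentComplex (Algebra.Extension.Cotangent.mk ⟨(x : MvPolynomial (Fin n) R), hmemker x⟩)
  have hvspan : Submodule.span L (Set.range v) = LinearMap.ker τ := by
    rw [LinearMap.exact_iff.mp hexact]
    apply le_antisymm
    · rw [Submodule.span_le]
      rintro _ ⟨x, rfl⟩
      exact ⟨(1 : L) ⊗ₜ[MvPolynomial (Fin n) R ⧸ I]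
        Algebra.Extension.Cotangent.mk ⟨(x : MvPolynomial (Fin n) R), hmemker x⟩,
        LinearMap.baseChange_tmul _ _ _⟩
    · rw [LinearMap.range_eq_map, ← span_one_tmul_eq_top L E.Cotangent, Submodule.map_span,
        Submodule.span_le]
      rintro _ ⟨_, ⟨y, rfl⟩, rfl⟩
      obtain ⟨z, rfl⟩ := Algebra.Extension.Cotangent.mk_surjective y
      obtain ⟨z0, hz0⟩ := z
      have hz : z0 ∈ I := by
        have h2 : z0 ∈ E.ker := hz0
        rwa [ker_quotientExtension] at h2
      refine Submodule.subset_span ⟨⟨z0, hz⟩, ?_⟩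
      exact (LinearMap.baseChange_tmul _ _ _).symm
  -- extract a basis of the kernel from the `v x`
  obtain ⟨κ, e, he, hspan, hli⟩ := exists_linearIndependent' L v
  haveI : Finite κ := hli.finite_of_isNoetherian
  letI : Fintype κ := Fintype.ofFinite κ
  have hcard : Fintype.card κ = n - d := by
    have h := finrank_span_eq_card hli
    rw [hspan, hvspan, hker] at h
    exact h.symm
  obtain ⟨g⟩ : Nonempty (Fin (n - d) ≃ κ) := ⟨(Fintype.equivFinOfCardEq hcard).symm⟩
  -- the relations and the matrix of their differentials at the point
  let f : Fin (n - d) → MvPolynomial (Fin n) R := fun i => (e (g i) : MvPolynomial (Fin n) R)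
  have hf : ∀ i, f i ∈ I := fun i => (e (g i)).2
  let w : Fin (n - d) → L ⊗[MvPolynomial (Fin n) R] Ω[MvPolynomial (Fin n) R⁄R] :=
    fun i => canc (v (e (g i)))
  have hw : ∀ i, w i = (1 : L) ⊗ₜ[MvPolynomial (Fin n) R] D R (MvPolynomial (Fin n) R) (f i) := by
    intro i
    change canc ((1 : L) ⊗ₜ[MvPolynomial (Fin n) R ⧸ I] E.cotangentComplex
      (Algebra.Extension.Cotangent.mk ⟨f i, hmemker (e (g i))⟩)) = _
    rw [Algebra.Extension.cotangentComplex_mk]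
    exact (TensorProduct.AlgebraTensorModule.cancelBaseChange_tmul _ _ _ _ _ _).trans
      (by rw [one_smul]; rfl)
  have hwli : LinearIndependent L w :=
    (hli.comp g g.injective).map' canc.toLinearMap canc.ker
  let M : Matrix (Fin (n - d)) (Fin n) L :=
    Matrix.of fun i j => algebraMap (MvPolynomial (Fin n) R) L (pderiv j (f i))
  -- rows of `M` = coordinates of the independent vectors `w i`
  have hrow : M.row = fun i => ⇑((tensorKaehlerBasis L).repr (w i)) := by
    funext i j
    change algebraMap (MvPolynomial (Fin n) R) L (pderiv j (f i)) = (tensorKaehlerBasis L).repr (w i) j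
    rw [hw, repr_tmul_D]
  have hMli : LinearIndependent L M.row := by
    rw [hrow]
    have h1 : LinearIndependent L (fun i => ((tensorKaehlerBasis L).repr (w i) : Fin n →₀ L)) :=
      hwli.map' (tensorKaehlerBasis L).repr.toLinearMap (tensorKaehlerBasis L).repr.ker
    exact h1.map' (Finsupp.linearEquivFunOnFinite L L (Fin n)).toLinearMap
      (Finsupp.linearEquivFunOnFinite L L (Fin n)).ker
  obtain ⟨a, ha, hdet⟩ := exists_submatrix_det_ne_zero_of_linearIndependent M hMli
  refine ⟨f, hf, a, ha, ?_⟩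
  -- `algebraMap (det N) = det (M.submatrix id a)ᵀ`
  rw [RingHom.map_det]
  have hN : (algebraMap (MvPolynomial (Fin n) R) L).mapMatrix
      (Matrix.of fun i j => (f j).pderiv (a i)) = (M.submatrix id a).transpose := by
    ext i j
    rfl
  rw [hN, Matrix.det_transpose]
  exact hdet

end Relations

end Literature.AlgebraicGeometry.Smoothening

end
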